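import Summits.AtomisticToContinuum.Crystallization.Theorems.FrustratedLawDichotomyStrainedPatchHomEntryRadialHcp

/-!
# SYMMETRY REDUCTION of the hcp half of `(H)`, part 1 (kit): the reflections `x ↦ −x`, `z ↦ −z` of the hcp structure, relabelling and tail

decomp-a2c hand-2 g23 (crux `AperiodicFrustratedLawGap`, stmt-AtomisticToContinuum-27623; the hcp twin of hand-1 g21's `…HomEntrySignKit`).
The stabiliser of an `A`-site of ideal hcp (`L_hex ∪ (L_hex + hcpShift)`, frame `hexFrame`) contains the two coordinate reflections `F₀ = diag(−1,1,1)` and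
`F₂ = diag(1,1,−1)` (Klein four-group with `F₀F₂`): `F₀ h₀ = −h₀`, `F₀ h₁ = h₁ − h₀`, `F₀ h₂ = h₂`, `F₀ s = s − h₀`; `F₂ hᵢ = hᵢ` (`i = 0,1`), `F₂ h₂ = −h₂`,
`F₂ s = s − h₂` (`s = hcpShift`, using `√(8/3) = 2√(2/3)`).  Hence the deformed structure of `(U, ξ)` and of the conjugate data `(Fᵢ U Fᵢ, Fᵢ ξ)` are
CONGRUENT (relabel family `A` by the involution `flipLabH i`, family `B` by the involution `shiftLabH i`), so the hcp dichotomy (prune ∨ floor) transfers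
— part 2 (`…HomEntryFlipHcp`) reduces the hcp half to the fundamental domain `ξ₀ ≥ 0`, `ξ₂ ≥ 0` (×4).  Unlike the fcc case the label cube `[−7,7]³` is
NOT invariant under the relabellings, so the box sums need the tail argument on both sides (`W₄₅ = 0` beyond `9/2`; labels outside the cube are `≥ 6`
resp. `≥ 25/4 − ‖ξ‖` long, `…HomLatticeBoxHcp.mem_box_of_norm_hexPt_lt` / `…_add_shift_lt`).

* §1 `flipLabH`, `shiftLabH` (involutions), ★ `flipIso_hexPt` / `flipIso_hexPt_shift` (frame action), norm invariance;
* §2 the conjugate `V = Fᵢ U Fᵢ`: `latPt V h b = Fᵢ (latPt U h (flipLabH i b))`, `V (s + Fᵢ ξ) = Fᵢ (latPt U h ℓᵢ + U (s + ξ))`;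
* §3 ★ a generic involution/tail summation lemma and the two box-sum identities `sumA (V) = sumA (U)`, `sumB (V, Fᵢξ) = sumB (U, ξ)`;
* §4 the realisation-set identity and ★★ `dichotomy_of_flipH` (the hcp dichotomy for `(Fᵢ U Fᵢ, Fᵢ ξ)` gives it for `(U, ξ)`).

0 sorry; standard axioms; no instances / notation / `#eval`.  `--supports stmt-AtomisticToContinuum-27623`.
-/

namespace Summit.AtomisticToContinuum.Crystallization.Theorems.FrustratedLawDichotomyStrainedPatchHomEntryFlipHcpKit

open scoped BigOperators RealInnerProductSpace
open Literature.Analysis.ValidatedNumerics.Numerics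
open Summit.AtomisticToContinuum.Crystallization.Theorems.ChargedEnergyGapNegative (E3)
open Summit.AtomisticToContinuum.Crystallization.Theorems.FrustratedLawDichotomySchurCut (effPot w₄₅ ω₄)
open Summit.AtomisticToContinuum.Crystallization.Theorems.FrustratedLawDichotomyAveragingRuleTightFree (TightNearCap BadNearCap)
open Summit.AtomisticToContinuum.Crystallization.Theorems.FrustratedLawDichotomyExemptAbsorption (ExemptNear)
open Summit.AtomisticToContinuum.Crystallization.Theorems.FrustratedLawDichotomyStrainedPatchHomSplit
open Summit.AtomisticToContinuum.Crystallization.Theorems.FrustratedLawDichotomyStrainedPatchHomPolar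
  (norm_apply_ge_of_norm_sub_one_le latPt_comp)
open Summit.AtomisticToContinuum.Crystallization.Theorems.FrustratedLawDichotomyStrainedPatchHomLattice (latPt_add)
open Summit.AtomisticToContinuum.Crystallization.Theorems.FrustratedLawDichotomyStrainedPatchHomLatticeBox (latPt_zero)
open Summit.AtomisticToContinuum.Crystallization.Theorems.FrustratedLawDichotomyStrainedPatchHomLatticeBoxHcp
  (latPt_eq_apply_one shifted_eq_apply mem_box_of_norm_hexPt_lt mem_box_of_norm_hexPt_add_shift_lt hexPt_apply_zero hexPt_apply_one hexPt_apply_two)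
open Summit.AtomisticToContinuum.Crystallization.Theorems.FrustratedLawDichotomyStrainedPatchHomIsometry (pruneHcp_comp)
open Summit.AtomisticToContinuum.Crystallization.Theorems.FrustratedLawDichotomyStrainedPatchHomTermCalculus (effPot45_eq_far)
open Summit.AtomisticToContinuum.Crystallization.Theorems.FrustratedLawDichotomyStrainedPatchHomEntryGramHcp (hcpShift_apply)
open Summit.AtomisticToContinuum.Crystallization.Theorems.FrustratedLawDichotomyStrainedPatchHomEntrySignKit
  (conjIso_apply flipIso flipIso_apply flipIso_symm conjIso_norm_sub_one_le)

/-! ## §1. Labels and the frame action of the two reflections -/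

/-- Relabelling of family `A` under `Fᵢ` (`i = 0`: `(b₀,b₁,b₂) ↦ (−b₀−b₁, b₁, b₂)`; otherwise (`i = 2`): `(b₀,b₁,b₂) ↦ (b₀, b₁, −b₂)`). -/
def flipLabH (i : Fin 3) (b : Fin 3 → ℤ) : Fin 3 → ℤ := if i = 0 then ![-b 0 - b 1, b 1, b 2] else ![b 0, b 1, -b 2]

/-- Relabelling of family `B` under `Fᵢ` (`flipLabH` followed by the lattice shift `ℓ₀ = (−1,0,0)` resp. `ℓ₂ = (0,0,−1)` of `Fᵢ s − s`). -/
def shiftLabH (i : Fin 3) (b : Fin 3 → ℤ) : Fin 3 → ℤ := if i = 0 then ![-b 0 - b 1 - 1, b 1, b 2] else ![b 0, b 1, -b 2 - 1]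

/-- `flipLabH i` is an involution. [formal bookkeeping] -/
theorem flipLabH_flipLabH (i : Fin 3) (b : Fin 3 → ℤ) : flipLabH i (flipLabH i b) = b := by
  funext k
  unfold flipLabH
  split_ifs <;> fin_cases k <;> simp

/-- `shiftLabH i` is an involution. [formal bookkeeping] -/
theorem shiftLabH_shiftLabH (i : Fin 3) (b : Fin 3 → ℤ) : shiftLabH i (shiftLabH i b) = b := by
  funext k
  unfold shiftLabH
  (split_ifs <;> fin_cases k <;> simp); omega

/-- `shiftLabH i b = flipLabH i b + shiftLabH i 0`. [formal bookkeeping] -/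
theorem shiftLabH_eq (i : Fin 3) (b : Fin 3 → ℤ) : shiftLabH i b = flipLabH i b + shiftLabH i 0 := by
  funext k
  unfold shiftLabH flipLabH
  split_ifs <;> fin_cases k <;> simp <;> omega

/-- `√(8/3) = 2 √(2/3)`. [formal bookkeeping] -/
theorem sqrt83_eq : Real.sqrt (8 / 3) = 2 * Real.sqrt (2 / 3) := by
  rw [show (8 : ℝ) / 3 = 2 ^ 2 * (2 / 3) by norm_num, Real.sqrt_mul (by norm_num), Real.sqrt_sq (by norm_num)]

/-- ★ **FRAME ACTION, family `A`**: `Fᵢ (Σ_j b_j h_j) = Σ_k (flipLabH i b)_k h_k` for `i ∈ {0, 2}`. [folklore] -/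
theorem flipIso_hexPt {i : Fin 3} (hi : i = 0 ∨ i = 2) (b : Fin 3 → ℤ) : flipIso i (latPt 1 hexFrame b) = latPt 1 hexFrame (flipLabH i b) := by
  ext a
  rw [flipIso_apply]
  rcases hi with rfl | rfl
  · match a with
    | 0 => simp [hexPt_apply_zero, flipLabH]; ring
    | 1 => simp [hexPt_apply_one, flipLabH]
    | 2 => simp [hexPt_apply_two, flipLabH]
  · match a with
    | 0 => simp [hexPt_apply_zero, flipLabH]
    | 1 => simp [hexPt_apply_one, flipLabH]
    | 2 => simp [hexPt_apply_two, flipLabH]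

/-- ★ **FRAME ACTION, family `B`**: `Fᵢ (Σ_j b_j h_j + s) = Σ_k (shiftLabH i b)_k h_k + s` for `i ∈ {0, 2}`. [folklore] -/
theorem flipIso_hexPt_shift {i : Fin 3} (hi : i = 0 ∨ i = 2) (b : Fin 3 → ℤ) :
    flipIso i (latPt 1 hexFrame b + hcpShift) = latPt 1 hexFrame (shiftLabH i b) + hcpShift := by
  ext a
  rw [flipIso_apply]
  rcases hi with rfl | rfl
  · match a with
    | 0 => simp [hexPt_apply_zero, hcpShift_apply, shiftLabH]; ring
    | 1 => simp [hexPt_apply_one, hcpShift_apply, shiftLabH]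
    | 2 => simp [hexPt_apply_two, hcpShift_apply, shiftLabH]
  · match a with
    | 0 => simp [hexPt_apply_zero, hcpShift_apply, shiftLabH]
    | 1 => simp [hexPt_apply_one, hcpShift_apply, shiftLabH]
    | 2 =>
      have h8 : Real.sqrt 8 = 2 * Real.sqrt 2 := by
        rw [show (8 : ℝ) = 2 ^ 2 * 2 by norm_num, Real.sqrt_mul (by norm_num), Real.sqrt_sq (by norm_num)]
      simp [hexPt_apply_two, hcpShift_apply, shiftLabH]
      rw [h8]; ring

/-- `Fᵢ s = latPt 1 h ℓᵢ + s` (`ℓᵢ = shiftLabH i 0`). [formal bookkeeping] -/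
theorem flipIso_hcpShift {i : Fin 3} (hi : i = 0 ∨ i = 2) : flipIso i hcpShift = latPt 1 hexFrame (shiftLabH i 0) + hcpShift := by
  have := flipIso_hexPt_shift hi 0
  rwa [latPt_zero, zero_add] at this

/-- Norm invariance of family-`A` labels under the relabelling. [formal bookkeeping] -/
theorem norm_hexPt_flipLabH {i : Fin 3} (hi : i = 0 ∨ i = 2) (b : Fin 3 → ℤ) : ‖latPt 1 hexFrame (flipLabH i b)‖ = ‖latPt 1 hexFrame b‖ := by
  rw [← flipIso_hexPt hi, LinearIsometryEquiv.norm_map]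

/-- Norm invariance of family-`B` labels under the relabelling. [formal bookkeeping] -/
theorem norm_hexPt_shift_shiftLabH {i : Fin 3} (hi : i = 0 ∨ i = 2) (b : Fin 3 → ℤ) :
    ‖latPt 1 hexFrame (shiftLabH i b) + hcpShift‖ = ‖latPt 1 hexFrame b + hcpShift‖ := by
  rw [← flipIso_hexPt_shift hi, LinearIsometryEquiv.norm_map]

/-- `Fᵢ (Fᵢ w) = w`. [formal bookkeeping] -/
theorem flipIso_flipIso (i : Fin 3) (w : E3) : flipIso i (flipIso i w) = w := by
  conv_lhs => rw [← flipIso_symm i]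
  exact (flipIso i).symm_apply_apply w

/-! ## §2. The conjugate data `(Fᵢ U Fᵢ, Fᵢ ξ)` -/

/-- ★ `latPt (Fᵢ U Fᵢ) h b = Fᵢ (latPt U h (flipLabH i b))`. [folklore] -/
theorem latPt_conj {i : Fin 3} (hi : i = 0 ∨ i = 2) (U : E3 →L[ℝ] E3) (b : Fin 3 → ℤ) :
    latPt ((flipIso i : E3 →L[ℝ] E3).comp (U.comp ((flipIso i).symm : E3 →L[ℝ] E3))) hexFrame b = flipIso i (latPt U hexFrame (flipLabH i b)) := by
  rw [latPt_eq_apply_one, conjIso_apply, flipIso_symm, flipIso_hexPt hi, ← latPt_eq_apply_one]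

/-- ★ `(Fᵢ U Fᵢ) (s + Fᵢ ξ) = Fᵢ (latPt U h ℓᵢ + U (s + ξ))`. [folklore] -/
theorem conj_shift {i : Fin 3} (hi : i = 0 ∨ i = 2) (U : E3 →L[ℝ] E3) (ξ : E3) :
    ((flipIso i : E3 →L[ℝ] E3).comp (U.comp ((flipIso i).symm : E3 →L[ℝ] E3))) (hcpShift + flipIso i ξ) =
      flipIso i (latPt U hexFrame (shiftLabH i 0) + U (hcpShift + ξ)) := by
  rw [conjIso_apply, flipIso_symm, map_add, flipIso_flipIso, flipIso_hcpShift hi, latPt_eq_apply_one U, ← map_add, add_assoc]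

/-- The conjugate's summand of family `B`: `latPt V h b + V (s + Fᵢξ) = Fᵢ (latPt U h (shiftLabH i b) + U (s + ξ))`. [folklore] -/
theorem conj_shifted_point {i : Fin 3} (hi : i = 0 ∨ i = 2) (U : E3 →L[ℝ] E3) (ξ : E3) (b : Fin 3 → ℤ) :
    latPt ((flipIso i : E3 →L[ℝ] E3).comp (U.comp ((flipIso i).symm : E3 →L[ℝ] E3))) hexFrame b +
        ((flipIso i : E3 →L[ℝ] E3).comp (U.comp ((flipIso i).symm : E3 →L[ℝ] E3))) (hcpShift + flipIso i ξ) =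
      flipIso i (latPt U hexFrame (shiftLabH i b) + U (hcpShift + ξ)) := by
  rw [latPt_conj hi, conj_shift hi, ← map_add, shiftLabH_eq i b, latPt_add]
  congr 1
  abel

/-! ## §3. Involution/tail summation and the two box sums -/

/-- ★ **INVOLUTION/TAIL SUMMATION**: for an involution `φ` and a function vanishing wherever `φ` leaves the finset (in both directions),
`Σ_{b ∈ S} F (φ b) = Σ_{b ∈ S} F b`. [folklore] -/
theorem sum_comp_invol_eq {S : Finset (Fin 3 → ℤ)} {φ : (Fin 3 → ℤ) → (Fin 3 → ℤ)} (hφ : ∀ b, φ (φ b) = b) {F : (Fin 3 → ℤ) → ℝ}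
    (h1 : ∀ b ∈ S, φ b ∉ S → F (φ b) = 0) (h2 : ∀ b ∈ S, φ b ∉ S → F b = 0) : ∑ b ∈ S, F (φ b) = ∑ b ∈ S, F b := by
  classical
  set S₁ := S.filter (fun b => φ b ∈ S) with hS₁
  have hl : ∑ b ∈ S, F (φ b) = ∑ b ∈ S₁, F (φ b) := by
    rw [hS₁, Finset.sum_filter]
    refine Finset.sum_congr rfl fun b hb => ?_
    split_ifs with h
    · rfl
    · exact h1 b hb h
  have hr : ∑ b ∈ S, F b = ∑ b ∈ S₁, F b := by
    rw [hS₁, Finset.sum_filter]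
    refine Finset.sum_congr rfl fun b hb => ?_
    split_ifs with h
    · rfl
    · exact h2 b hb h
  rw [hl, hr]
  refine Finset.sum_nbij' φ φ (fun b hb => ?_) (fun b hb => ?_) (fun b _ => hφ b) (fun b _ => hφ b) (fun b _ => rfl)
  · obtain ⟨hbS, hφb⟩ := Finset.mem_filter.1 hb
    exact Finset.mem_filter.2 ⟨hφb, by rw [hφ]; exact hbS⟩
  · obtain ⟨hbS, hφb⟩ := Finset.mem_filter.1 hb
    exact Finset.mem_filter.2 ⟨hφb, by rw [hφ]; exact hbS⟩

/-- ★ **BOX SUM OF FAMILY `A` IS FLIP-INVARIANT** (tail argument: labels outside `[−7,7]³` are `≥ 6` long, `W₄₅ = 0` beyond `9/2`). [folklore] -/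
theorem boxSumA_flip {i : Fin 3} (hi : i = 0 ∨ i = 2) (U : E3 →L[ℝ] E3) (hU : ‖U - 1‖ ≤ 1 / 4) :
    ∑ b ∈ (Fintype.piFinset fun _ : Fin 3 => Finset.Icc (-7 : ℤ) 7).filter (fun b => b ≠ 0),
        effPot w₄₅ ω₄ (3 / 400) ‖latPt ((flipIso i : E3 →L[ℝ] E3).comp (U.comp ((flipIso i).symm : E3 →L[ℝ] E3))) hexFrame b‖ =
      ∑ b ∈ (Fintype.piFinset fun _ : Fin 3 => Finset.Icc (-7 : ℤ) 7).filter (fun b => b ≠ 0), effPot w₄₅ ω₄ (3 / 400) ‖latPt U hexFrame b‖ := by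
  classical
  have far : ∀ b : Fin 3 → ℤ, b ∉ (Fintype.piFinset fun _ : Fin 3 => Finset.Icc (-7 : ℤ) 7) → effPot w₄₅ ω₄ (3 / 400) ‖latPt U hexFrame b‖ = 0 := by
    intro b hb
    have h6 : (6 : ℝ) ≤ ‖latPt 1 hexFrame b‖ := not_lt.1 fun h => hb (mem_box_of_norm_hexPt_lt h)
    have h34 := norm_apply_ge_of_norm_sub_one_le hU (latPt 1 hexFrame b)
    rw [← latPt_eq_apply_one] at h34
    exact effPot45_eq_far (by linarith)
  have hzero : ∀ b : Fin 3 → ℤ, flipLabH i b = 0 ↔ b = 0 := fun b =>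
    ⟨fun h => by rw [← flipLabH_flipLabH i b, h]; unfold flipLabH; split_ifs <;> (funext k; fin_cases k <;> simp),
     fun h => by rw [h]; unfold flipLabH; split_ifs <;> (funext k; fin_cases k <;> simp)⟩
  have e1 : ∀ b, effPot w₄₅ ω₄ (3 / 400) ‖latPt ((flipIso i : E3 →L[ℝ] E3).comp (U.comp ((flipIso i).symm : E3 →L[ℝ] E3))) hexFrame b‖ =
      effPot w₄₅ ω₄ (3 / 400) ‖latPt U hexFrame (flipLabH i b)‖ := fun b => by rw [latPt_conj hi, LinearIsometryEquiv.norm_map]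
  rw [Finset.sum_congr rfl fun b _ => e1 b]
  refine sum_comp_invol_eq (φ := flipLabH i) (F := fun b => effPot w₄₅ ω₄ (3 / 400) ‖latPt U hexFrame b‖) (flipLabH_flipLabH i)
    (fun b hb hφ => ?_) (fun b hb hφ => ?_)
  · -- φ b ∉ box∖0, b ∈ box∖0 ⇒ φ b ∉ box
    have hb0 : b ≠ 0 := (Finset.mem_filter.1 hb).2
    have hφ' : flipLabH i b ∉ (Fintype.piFinset fun _ : Fin 3 => Finset.Icc (-7 : ℤ) 7) := fun h =>
      hφ (Finset.mem_filter.2 ⟨h, fun h0 => hb0 ((hzero b).1 h0)⟩)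
    exact far _ hφ'
  · have hb0 : b ≠ 0 := (Finset.mem_filter.1 hb).2
    have hφ' : flipLabH i b ∉ (Fintype.piFinset fun _ : Fin 3 => Finset.Icc (-7 : ℤ) 7) := fun h =>
      hφ (Finset.mem_filter.2 ⟨h, fun h0 => hb0 ((hzero b).1 h0)⟩)
    have h6 : (6 : ℝ) ≤ ‖latPt 1 hexFrame b‖ := by
      rw [← norm_hexPt_flipLabH hi]
      exact not_lt.1 fun h => hφ' (mem_box_of_norm_hexPt_lt h)
    have h34 := norm_apply_ge_of_norm_sub_one_le hU (latPt 1 hexFrame b)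
    rw [← latPt_eq_apply_one] at h34
    exact effPot45_eq_far (by linarith)

/-- ★ **BOX SUM OF FAMILY `B` IS FLIP-INVARIANT** (tail: labels outside `[−7,7]³` are `≥ 25/4 − ‖ξ‖` long after the shift). [folklore] -/
theorem boxSumB_flip {i : Fin 3} (hi : i = 0 ∨ i = 2) (U : E3 →L[ℝ] E3) (ξ : E3) (hU : ‖U - 1‖ ≤ 1 / 4) (hξ : ‖ξ‖ ≤ 1 / 4) :
    ∑ b ∈ (Fintype.piFinset fun _ : Fin 3 => Finset.Icc (-7 : ℤ) 7),
        effPot w₄₅ ω₄ (3 / 400) ‖latPt ((flipIso i : E3 →L[ℝ] E3).comp (U.comp ((flipIso i).symm : E3 →L[ℝ] E3))) hexFrame b +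
          ((flipIso i : E3 →L[ℝ] E3).comp (U.comp ((flipIso i).symm : E3 →L[ℝ] E3))) (hcpShift + flipIso i ξ)‖ =
      ∑ b ∈ (Fintype.piFinset fun _ : Fin 3 => Finset.Icc (-7 : ℤ) 7), effPot w₄₅ ω₄ (3 / 400) ‖latPt U hexFrame b + U (hcpShift + ξ)‖ := by
  classical
  have farN : ∀ b : Fin 3 → ℤ, (25 : ℝ) / 4 ≤ ‖latPt 1 hexFrame b + hcpShift‖ → effPot w₄₅ ω₄ (3 / 400) ‖latPt U hexFrame b + U (hcpShift + ξ)‖ = 0 := by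
    intro b h6
    have h34 := norm_apply_ge_of_norm_sub_one_le hU (latPt 1 hexFrame b + hcpShift + ξ)
    rw [← shifted_eq_apply] at h34
    have htri : ‖latPt 1 hexFrame b + hcpShift‖ - ‖ξ‖ ≤ ‖latPt 1 hexFrame b + hcpShift + ξ‖ := by
      have := norm_sub_le (latPt 1 hexFrame b + hcpShift + ξ) ξ
      rw [add_sub_cancel_right] at this
      linarith
    exact effPot45_eq_far (by nlinarith)
  have far : ∀ b : Fin 3 → ℤ, b ∉ (Fintype.piFinset fun _ : Fin 3 => Finset.Icc (-7 : ℤ) 7) →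
      effPot w₄₅ ω₄ (3 / 400) ‖latPt U hexFrame b + U (hcpShift + ξ)‖ = 0 := fun b hb =>
    farN b (not_lt.1 fun h => hb (mem_box_of_norm_hexPt_add_shift_lt h))
  have e1 : ∀ b, effPot w₄₅ ω₄ (3 / 400) ‖latPt ((flipIso i : E3 →L[ℝ] E3).comp (U.comp ((flipIso i).symm : E3 →L[ℝ] E3))) hexFrame b +
      ((flipIso i : E3 →L[ℝ] E3).comp (U.comp ((flipIso i).symm : E3 →L[ℝ] E3))) (hcpShift + flipIso i ξ)‖ =
      effPot w₄₅ ω₄ (3 / 400) ‖latPt U hexFrame (shiftLabH i b) + U (hcpShift + ξ)‖ := fun b => by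
    rw [conj_shifted_point hi, LinearIsometryEquiv.norm_map]
  rw [Finset.sum_congr rfl fun b _ => e1 b]
  refine sum_comp_invol_eq (φ := shiftLabH i) (F := fun b => effPot w₄₅ ω₄ (3 / 400) ‖latPt U hexFrame b + U (hcpShift + ξ)‖)
    (shiftLabH_shiftLabH i) (fun b _ hφ => far _ hφ) (fun b _ hφ => ?_)
  have h6 : (25 : ℝ) / 4 ≤ ‖latPt 1 hexFrame b + hcpShift‖ := by
    rw [← norm_hexPt_shift_shiftLabH hi]
    exact not_lt.1 fun h => hφ (mem_box_of_norm_hexPt_add_shift_lt h)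
  exact farN b h6

/-! ## §4. The realisation set and the transfer of the dichotomy -/

/-- The realisation set of the `(U, ξ)`-hcp ball equals that of the `(Fᵢ⁻¹ ∘ V, s + Fᵢ ξ)` data, `V = Fᵢ U Fᵢ` (relabel the two families by the
involutions `flipLabH i`, `shiftLabH i`). [folklore] -/
theorem range_set_eq_flipH {i : Fin 3} (hi : i = 0 ∨ i = 2) (U : E3 →L[ℝ] E3) (ξ : E3) (ϱ : ℝ) (x0 : E3) :
    {x : E3 | dist x x0 ≤ ϱ ∧ ∃ a : Fin 3 → ℤ, x = x0 + latPt U hexFrame a ∨ x = x0 + latPt U hexFrame a + U (hcpShift + ξ)} =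
      {x : E3 | dist x x0 ≤ ϱ ∧ ∃ a : Fin 3 → ℤ,
        x = x0 + latPt ((((flipIso i).symm : E3 ≃ₗᵢ[ℝ] E3) : E3 →L[ℝ] E3).comp
          ((flipIso i : E3 →L[ℝ] E3).comp (U.comp ((flipIso i).symm : E3 →L[ℝ] E3)))) hexFrame a ∨
        x = x0 + latPt ((((flipIso i).symm : E3 ≃ₗᵢ[ℝ] E3) : E3 →L[ℝ] E3).comp
          ((flipIso i : E3 →L[ℝ] E3).comp (U.comp ((flipIso i).symm : E3 →L[ℝ] E3)))) hexFrame a +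
          ((((flipIso i).symm : E3 ≃ₗᵢ[ℝ] E3) : E3 →L[ℝ] E3).comp
            ((flipIso i : E3 →L[ℝ] E3).comp (U.comp ((flipIso i).symm : E3 →L[ℝ] E3)))) (hcpShift + flipIso i ξ)} := by
  have eA : ∀ a, latPt ((((flipIso i).symm : E3 ≃ₗᵢ[ℝ] E3) : E3 →L[ℝ] E3).comp
      ((flipIso i : E3 →L[ℝ] E3).comp (U.comp ((flipIso i).symm : E3 →L[ℝ] E3)))) hexFrame a = latPt U hexFrame (flipLabH i a) := fun a => by
    rw [latPt_comp, latPt_conj hi, LinearIsometryEquiv.symm_apply_apply]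
  have eB : ((((flipIso i).symm : E3 ≃ₗᵢ[ℝ] E3) : E3 →L[ℝ] E3).comp
      ((flipIso i : E3 →L[ℝ] E3).comp (U.comp ((flipIso i).symm : E3 →L[ℝ] E3)))) (hcpShift + flipIso i ξ) =
      latPt U hexFrame (shiftLabH i 0) + U (hcpShift + ξ) := by
    rw [ContinuousLinearMap.comp_apply, conj_shift hi]
    exact (flipIso i).symm_apply_apply _
  ext x
  simp only [Set.mem_setOf_eq]
  refine and_congr_right fun _ => ⟨?_, ?_⟩
  · rintro ⟨a, ha | ha⟩
    · exact ⟨flipLabH i a, Or.inl (by rw [eA, flipLabH_flipLabH]; exact ha)⟩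
    · refine ⟨shiftLabH i a, Or.inr ?_⟩
      have key : latPt U hexFrame (flipLabH i (shiftLabH i a)) + latPt U hexFrame (shiftLabH i 0) = latPt U hexFrame a := by
        rw [← latPt_add, ← shiftLabH_eq, shiftLabH_shiftLabH]
      rw [eA, eB, ha, ← key]
      abel
  · rintro ⟨a, ha | ha⟩
    · exact ⟨flipLabH i a, Or.inl (by rw [eA] at ha; exact ha)⟩
    · refine ⟨shiftLabH i a, Or.inr ?_⟩
      have key : latPt U hexFrame (flipLabH i a) + latPt U hexFrame (shiftLabH i 0) = latPt U hexFrame (shiftLabH i a) := by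
        rw [← latPt_add, ← shiftLabH_eq]
      rw [eA, eB] at ha
      rw [ha, ← key]
      abel

/-- ★★ **TRANSFER**: the hcp dichotomy (prune ∨ `m`-floor) for the conjugate data `(Fᵢ U Fᵢ, Fᵢ ξ)` gives it for `(U, ξ)` (`‖U − 1‖ ≤ 1/4`,
`‖ξ‖ ≤ 1/4`, `i ∈ {0, 2}`). [folklore] -/
theorem dichotomy_of_flipH {i : Fin 3} (hi : i = 0 ∨ i = 2) (U : E3 →L[ℝ] E3) (ξ : E3) (hU : ‖U - 1‖ ≤ 1 / 4) (hξ : ‖ξ‖ ≤ 1 / 4) {m : ℝ}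
    (h : (∀ (M : ℕ) (z : Fin M → E3) (c : Fin M), Function.Injective z →
        Set.range z = {x : E3 | dist x (z c) ≤ 133 / 10 ∧ ∃ a : Fin 3 → ℤ,
          x = z c + latPt ((flipIso i : E3 →L[ℝ] E3).comp (U.comp ((flipIso i).symm : E3 →L[ℝ] E3))) hexFrame a ∨
          x = z c + latPt ((flipIso i : E3 →L[ℝ] E3).comp (U.comp ((flipIso i).symm : E3 →L[ℝ] E3))) hexFrame a +
            ((flipIso i : E3 →L[ℝ] E3).comp (U.comp ((flipIso i).symm : E3 →L[ℝ] E3))) (hcpShift + flipIso i ξ)} →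
        TightNearCap (9 / 5) (3 / 2) z c ∨ ExemptNear (9 / 5) ExRec z c ∨ BadNearCap (9 / 5) (3 / 2) z c) ∨
      m ≤ (∑ b ∈ (Fintype.piFinset fun _ : Fin 3 => Finset.Icc (-7 : ℤ) 7).filter (fun b => b ≠ 0),
          effPot w₄₅ ω₄ (3 / 400) ‖latPt ((flipIso i : E3 →L[ℝ] E3).comp (U.comp ((flipIso i).symm : E3 →L[ℝ] E3))) hexFrame b‖ +
        ∑ b ∈ (Fintype.piFinset fun _ : Fin 3 => Finset.Icc (-7 : ℤ) 7),
          effPot w₄₅ ω₄ (3 / 400) ‖latPt ((flipIso i : E3 →L[ℝ] E3).comp (U.comp ((flipIso i).symm : E3 →L[ℝ] E3))) hexFrame b +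
            ((flipIso i : E3 →L[ℝ] E3).comp (U.comp ((flipIso i).symm : E3 →L[ℝ] E3))) (hcpShift + flipIso i ξ)‖) / 2 -
        (-(7175 / 10000) + 3 / 400)) :
    (∀ (M : ℕ) (z : Fin M → E3) (c : Fin M), Function.Injective z →
        Set.range z = {x : E3 | dist x (z c) ≤ 133 / 10 ∧ ∃ a : Fin 3 → ℤ,
          x = z c + latPt U hexFrame a ∨ x = z c + latPt U hexFrame a + U (hcpShift + ξ)} →
        TightNearCap (9 / 5) (3 / 2) z c ∨ ExemptNear (9 / 5) ExRec z c ∨ BadNearCap (9 / 5) (3 / 2) z c) ∨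
      m ≤ (∑ b ∈ (Fintype.piFinset fun _ : Fin 3 => Finset.Icc (-7 : ℤ) 7).filter (fun b => b ≠ 0),
          effPot w₄₅ ω₄ (3 / 400) ‖latPt U hexFrame b‖ +
        ∑ b ∈ (Fintype.piFinset fun _ : Fin 3 => Finset.Icc (-7 : ℤ) 7),
          effPot w₄₅ ω₄ (3 / 400) ‖latPt U hexFrame b + U (hcpShift + ξ)‖) / 2 - (-(7175 / 10000) + 3 / 400) := by
  rcases h with h | h
  · left
    intro M z c hz hrange
    rw [range_set_eq_flipH hi U ξ (133 / 10) (z c)] at hrange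
    exact pruneHcp_comp (flipIso i).symm _ hexFrame (hcpShift + flipIso i ξ) (133 / 10) h M z c hz hrange
  · right; rwa [boxSumA_flip hi U hU, boxSumB_flip hi U ξ hU hξ] at h

end Summit.AtomisticToContinuum.Crystallization.Theorems.FrustratedLawDichotomyStrainedPatchHomEntryFlipHcpKit
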